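import Mathlib
import HarnessLib
import Summits.HubbardSuperconductivity.HubbardSuperconductivity.Theorems.KLProgrammePerturbedFermiCurveCooperSlope
import Summits.HubbardSuperconductivity.HubbardSuperconductivity.Theorems.KLProgrammePerturbedFermiCurveCooperCount
import Summits.HubbardSuperconductivity.HubbardSuperconductivity.Theorems.KLProgrammeKLRegimeTwoPointLimitShellMeasure1D

/-!
# Route `KLProgramme` — ENGINE child (stmt-HubbardSuperconductivity-20437 `KLRegimeEngineV17F2`): the LINEAR LAW of the two-shell bound on the frame's Fermi curve —
# the angular sublevel set `{θ : |E(p(θ) − v) − ν| ≤ δ}` of one period has measure `≤ 10·δ/Λ` in the Cooper regime (step (T2); frame analogue of p1b's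
# `klsa_volume_sublevel_le_cooper`; design note HOME/hubbard-kl-k3c2-p2/TWO-SHELL-FRAME-PORT.md §6–§7)

Cell `gate-hubbard-kl`, seat hubbard-kl-k3c2-p2 g15.  Assembly of p1b's one-dimensional shell-measure lemma `klsm_volume_sublevel_le` with the frame bricks: the
derivative `hasDerivAt_transLevel`, the slope lower bound `slope_lower_bound_of_geomConstants` (transfer NOT `R₀`-close to `2πℤ²`, `2p(θ) − v` NOT `R₀`-close to
`2πℤ²`, alternative radius `R(Λ) ≤ R₀`) — used twice: on the `δ`-sublevel set (slope `≥ Λ`) and on the Cooper arcs (level defect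
`η_A = Λ_max·r·(π/2)s + Kc·r²`, `abs_transLevel_le_on_arc`) — and the zero count `zeros_card_le_three_of_geomConstants` (`#Z ≤ 3`):
**`volume_sublevel_le_cooper_of_geomConstants`** — `vol{θ ∈ [θ₀, θ₀ + 2π] : |E(p(θ) − r·dir ψ) − ν| ≤ δ} ≤ 5·(2δ/Λ)`.
In the assembly `Λ ≍ r = |v|` (the crossing slope of a small translate), giving DECOMP App. E Lemma E.1's `C·δ/|v|` per level curve of the frame.
Everything is PROVED; no definitions, no named facts; nothing asserts any stub or superconductivity.
References: DECOMP App. E Lemma E.1; FST II App. B [cite: FeldmanSalmhoferTrubowitz1998]; BGM 2006 §2.4, §2.7 [cite: BenfattoGiulianiMastropietro2006].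
-/

noncomputable section

namespace Summit.HubbardSuperconductivity.HubbardSuperconductivity.Theorems.PerturbedFermiCurve

set_option linter.dupNamespace false -- summit = problem name (single-conjunct summit), D-0017

open Real Set MeasureTheory
open scoped ENNReal
open Literature.MathematicalPhysics.QuantumLattice Literature.MathematicalPhysics.QuantumLattice.BandSectorCounting
open Literature.MathematicalPhysics.QuantumLattice.FermiRG
open Summit.HubbardSuperconductivity.HubbardSuperconductivity.Theorems.DispersionFlow
open Summit.HubbardSuperconductivity.HubbardSuperconductivity.Theorems.KLRegimeSplit

section Frame

variable {a b : ℝ} (B : BandBounds a b) {K : TrigPolyC4v} {κ₀ κ₁ : ℝ}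
  (hδ : ∀ k : Fin 2 → ℝ, (∀ i, |k i| ≤ π) → |(fun k : Fin 2 → ℝ => -K.eval k) k| ≤ κ₀)
  (hκ : ∀ k : Fin 2 → ℝ, (∀ i, |k i| ≤ π) → ‖fderiv ℝ (fun k : Fin 2 → ℝ => -K.eval k) k‖ ≤ κ₁) (hκ₁ : κ₁ < B.Dtmin)
  {μ Kc r₀ g₀ w : ℝ} (hG : GeomConstants (frameLevel μ K) Kc r₀ g₀ w) {ν : ℝ} (hν : |ν - μ| < r₀)
include B hδ hκ hκ₁ hG hν

/-- **Linear law (Cooper regime) for one level curve of the frame.**  `p = perturbedFermiRadius δ_K ν·dir`, transfer `v = r·dir ψ` (`0 < r`), `Kc·r/(Dt_min − κ₁) ≤ s < 1`,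
arc defect `η_A = (4+κ₁)√2 S_E/u_min·r·(π/2)s + Kc r²`; the levels `ν ± (κ₀ + δ)` and `ν ± (κ₀ + η_A)` admissible; `v` and every `2p(θ) − v` NOT `R₀`-close to `2πℤ²`;
and the alternative radii `R(Λ; δ)`, `R(Λ; η_A)` are `≤ R₀`.  Then `vol{θ ∈ [θ₀, θ₀ + 2π] : |E(p(θ) − v) − ν| ≤ δ} ≤ 5·(2δ/Λ)`.
[cite: FeldmanSalmhoferTrubowitz1998, App. B] -/
theorem volume_sublevel_le_cooper_of_geomConstants {r ψ s δ Λ R₀ : ℝ} (θ₀ : ℝ) (hr : 0 < r) (hs0 : 0 ≤ s) (hs1 : s < 1)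
    (hrs : Kc * r / (B.Dtmin - κ₁) ≤ s) (hΛ : 0 < Λ)
    (hloδ : a ≤ ν - κ₀ - δ) (hhiδ : ν + κ₀ + δ ≤ b)
    (hloA : a ≤ ν - κ₀ - ((4 + κ₁) * (Real.sqrt 2 * (B.smax + κ₁ * (π * Real.sqrt 2 + 2 * B.smax) / (B.Dtmin - κ₁))) / B.umin * (r * (π / 2 * s)) + Kc * r ^ 2))
    (hhiA : ν + κ₀ + ((4 + κ₁) * (Real.sqrt 2 * (B.smax + κ₁ * (π * Real.sqrt 2 + 2 * B.smax) / (B.Dtmin - κ₁))) / B.umin * (r * (π / 2 * s)) + Kc * r ^ 2) ≤ b)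
    (hfar : ∀ m : Fin 2 → ℤ, ∃ i, R₀ < |(r • dir ψ) i + m i * (2 * π)|)
    (hnc : ∀ (θ : ℝ) (m : Fin 2 → ℤ), ∃ i,
      R₀ < |2 * (perturbedFermiRadius (fun k : Fin 2 → ℝ => -K.eval k) ν θ • dir θ) i - (r • dir ψ) i - m i * (2 * π)|)
    (hRδ : (δ + B.smax * B.Dtmin *
        ((π / 2 * Λ / ((B.Dtmin - κ₁) * B.umin) + π * Kc * δ / (B.Dtmin - κ₁) ^ 2) * (4 + κ₁) / (B.umin * w))) / (B.Dtmin - κ₁) ≤ R₀)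
    (hRA : (((4 + κ₁) * (Real.sqrt 2 * (B.smax + κ₁ * (π * Real.sqrt 2 + 2 * B.smax) / (B.Dtmin - κ₁))) / B.umin * (r * (π / 2 * s)) + Kc * r ^ 2) +
        B.smax * B.Dtmin * ((π / 2 * Λ / ((B.Dtmin - κ₁) * B.umin) +
          π * Kc * ((4 + κ₁) * (Real.sqrt 2 * (B.smax + κ₁ * (π * Real.sqrt 2 + 2 * B.smax) / (B.Dtmin - κ₁))) / B.umin * (r * (π / 2 * s)) + Kc * r ^ 2) /
            (B.Dtmin - κ₁) ^ 2) * (4 + κ₁) / (B.umin * w))) / (B.Dtmin - κ₁) ≤ R₀) :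
    volume {θ ∈ Icc θ₀ (θ₀ + 2 * π) |
        |sqDispersion (perturbedFermiRadius (fun k : Fin 2 → ℝ => -K.eval k) ν θ • dir θ - r • dir ψ) +
            -K.eval (perturbedFermiRadius (fun k : Fin 2 → ℝ => -K.eval k) ν θ • dir θ - r • dir ψ) - ν| ≤ δ} ≤
      5 * ENNReal.ofReal (2 * δ / Λ) := by
  set δK : (Fin 2 → ℝ) → ℝ := fun k : Fin 2 → ℝ => -K.eval k with hδK
  set u := perturbedFermiRadius δK ν with hudef
  set v : Fin 2 → ℝ := r • dir ψ with hv
  set ηA := (4 + κ₁) * (Real.sqrt 2 * (B.smax + κ₁ * (π * Real.sqrt 2 + 2 * B.smax) / (B.Dtmin - κ₁))) / B.umin * (r * (π / 2 * s)) + Kc * r ^ 2 with hηA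
  set g : ℝ → ℝ := fun t => sqDispersion (u t • dir t - v) + -K.eval (u t • dir t - v) - ν with hg
  set ℓ : ℝ → ℝ := fun t => 2 * Real.sin ((u t • dir t - v) 0) * VXE u t + 2 * Real.sin ((u t • dir t - v) 1) * VYE u t +
      fderiv ℝ δK (u t • dir t - v) ![VXE u t, VYE u t] with hℓ
  -- admissibility of the level itself and the root selection
  have hδ0 : 0 ≤ δ ∨ δ < 0 := le_or_gt 0 δ
  have hκ₀ : 0 ≤ κ₀ := by
    have h := hδ (fun _ => 0) (fun i => by simp [Real.pi_pos.le])
    exact (abs_nonneg _).trans h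
  have hηA0 : 0 ≤ ηA := by
    have hsq : ∀ i, |(fun _ : Fin 2 => (0 : ℝ)) i| ≤ π := fun i => by simp [Real.pi_pos.le]
    have hκ₁0 : 0 ≤ κ₁ := le_trans (norm_nonneg _) (hκ _ hsq)
    have hKc : 0 ≤ Kc := le_trans (norm_nonneg _) (hG.norm_iteratedFDeriv_le (WithLp.toLp 2 fun _ : Fin 2 => (0 : ℝ)) 0 (by norm_num))
    have hD : 0 < B.Dtmin - κ₁ := sub_pos.2 hκ₁
    have := B.smax_pos; have := B.umin_pos
    positivity
  have hlo : a ≤ ν - κ₀ := by linarith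
  have hhi : ν + κ₀ ≤ b := by linarith
  have hδc : Continuous δK := (contDiff_frameShift_toLp K (m := 0)).continuous
  have hδs : ContDiff ℝ 2 δK := contDiff_frameShift_toLp K
  have hu : ∀ θ, IsBandFermiRadius (ν - δK (u θ • dir θ)) θ (u θ) := isBandFermiRadius_perturbedFermiRadius B hδc hδ hlo hhi
  have hper : Function.Periodic u (2 * π) := fun θ => perturbedFermiRadius_add_two_pi δK ν θ
  have h2ne : (2 : WithTop ℕ∞) ≠ 0 := by norm_num
  have hudiff : Differentiable ℝ u := (contDiff_of_isRoot B hδs h2ne hδ hlo hhi hκ hκ₁ hu).differentiable h2ne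
  -- derivative
  have hgd : ∀ t, HasDerivAt g (ℓ t) t := fun t => (hasDerivAt_transLevel K hudiff v t).sub_const ν
  -- slope bound at any angle where the level defect is `≤ η'` with `R(Λ; η') ≤ R₀`
  have hslope : ∀ (t η' : ℝ), |g t| ≤ η' → a ≤ ν - κ₀ - η' → ν + κ₀ + η' ≤ b →
      (η' + B.smax * B.Dtmin * ((π / 2 * Λ / ((B.Dtmin - κ₁) * B.umin) + π * Kc * η' / (B.Dtmin - κ₁) ^ 2) * (4 + κ₁) / (B.umin * w))) /
        (B.Dtmin - κ₁) ≤ R₀ → Λ < |ℓ t| := by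
    intro t η' hlev hlo' hhi' hR'
    exact slope_lower_bound_of_geomConstants B hδ hκ hκ₁ hG hν t hlev hlo' hhi' hfar (hnc t) hR'
  -- the zero count
  obtain ⟨Z, hZ3, hZ⟩ := zeros_card_le_three_of_geomConstants B hδ hlo hhi hκ hκ₁ hu hper hG hν hr hs0 hs1 hrs (half_pos hΛ) ℓ
    (fun t => hasDerivAt_transLevel K hudiff v t)
    (fun θ k harc => by
      have hlevA : |g θ| ≤ ηA := abs_transLevel_le_on_arc B hδ hlo hhi hκ hκ₁ hu hG hr.le harc
      have h := hslope θ ηA hlevA hloA hhiA hRA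
      linarith [h])
  -- the one-dimensional shell-measure lemma
  have htrans : ∀ t ∈ Icc θ₀ (θ₀ + 2 * π), |g t| ≤ δ → Λ ≤ |ℓ t| :=
    fun t _ hgt => (hslope t δ hgt hloδ hhiδ hRδ).le
  have hzeros : ∀ c ∈ Icc θ₀ (θ₀ + 2 * π), g c = 0 → c ∈ Z := by
    intro c hc hgc
    refine hZ c hc ?_
    have : sqDispersion (u c • dir c - v) + -K.eval (u c • dir c - v) - ν = 0 := hgc
    linarith
  have hmain := klsm_volume_sublevel_le hgd hΛ htrans Z hzeros
  refine hmain.trans ?_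
  have hcard : ((Z.card : ℝ≥0∞) + 2) ≤ 5 := by
    have : (Z.card : ℝ≥0∞) ≤ 3 := by exact_mod_cast hZ3
    calc ((Z.card : ℝ≥0∞) + 2) ≤ 3 + 2 := add_le_add this le_rfl
      _ = 5 := by norm_num
  exact mul_le_mul' hcard le_rfl

end Frame

end Summit.HubbardSuperconductivity.HubbardSuperconductivity.Theorems.PerturbedFermiCurve

end
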